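import Mathlib.Algebra.FreeAlgebra
import Mathlib.LinearAlgebra.FreeAlgebra
import Mathlib.Algebra.Lie.UniversalEnveloping
import Mathlib.Analysis.Calculus.ContDiff.Basic
import Mathlib.Analysis.Calculus.Deriv.Basic
import Mathlib.Analysis.Calculus.Deriv.Mul
import Mathlib.Analysis.Complex.Basic
import Literature.NumberTheory.Automorphic.RealMatrixGroups
import Literature.NumberTheory.Automorphic.GKModules
import HarnessLib

-- provenance: harness21/H21/H21/Prelude/AutomorphicL/ArchimedeanCalculus.lean @ 5ace009 (interim HEAD d8f2665); M5 mechanical rewrite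
/-!
# Archimedean calculus: Lie derivatives, `U(𝔤)`-words, `Z(𝔤)`- and `K`-finiteness

Trunk: AutomorphicL (prelude, item I11 `ArchimedeanCalculus`; notions `automorphic_form`,
`archimedean_gK_module`; design D2).

Let `H : RealMatrixGroup A N` be a linear real group (`𝔤 = H.lie`, `K = H.maximalCompact`) and let
`ι : ↥H.carrier →* G` be a homomorphism into an abstract group `G` (typically `G = 𝒢(𝔸_K)` and
`ι` the inclusion of the archimedean component). For a function `φ : G → ℂ` we define, following
Borel–Jacquet, *Automorphic forms and automorphic representations* (Corvallis 1979), §1.1–1.6: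

* `IsArchSmooth ι φ` — smoothness in the archimedean variable: `X ↦ φ (g · ι (exp X))` is
  `C^∞` on `𝔤` for every `g` (H3/H4: `ContDiff ℝ ∞`, `𝔤` normed by the `L^∞`-operator norm opened
  locally); `archSmooth ι` — the complex subspace of such functions.
* `lieDeriv ι X φ g = d/dt φ (g · ι (exp tX)) |_{t=0}` — the action of `X ∈ 𝔤` by right-invariant
  differentiation (BJ §1.5), `iterLieDeriv ι [X₁, …, Xₙ] φ = X₁ (X₂ (⋯ (Xₙ φ)))`.
* `applyFree ι p φ` — the action of a non-commutative polynomial `p : FreeAlgebra ℝ 𝔤` (a real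
  linear combination of words, via Mathlib's `FreeAlgebra.basisFreeMonoid`) on `φ`;
  `freeToEnveloping : FreeAlgebra ℝ 𝔤 →ₐ[ℝ] U(𝔤)` — the canonical surjection; `IsCentralWord p` —
  the image of `p` lies in `Z(𝔤) = centerU H`. Making `U(𝔤)` act *through words* keeps
  `Z(𝔤)`-finiteness total and junk-free (D2): on smooth `φ` the action factors through `U(𝔤)`
  (`applyFree_congr`).
* `IsZFinite ι φ` — the functions `z φ`, `z` a central word, span a finite-dimensional space
  (BJ §1.6, §4.2(c)); `HasZCharacter ι φ θ` — `z φ = θ(z) φ` for an algebra map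
  `θ : Z(𝔤) →ₐ[ℝ] ℂ`.
* `archTranslate ι : Representation ℂ ↥H.carrier (G → ℂ)` — right translation
  `(r(h) φ)(g) = φ (g · ι h)`; `IsKFinite ι φ` — the right `K`-translates of `φ` span a
  finite-dimensional space (BJ §1.3, §4.2(b)).

## Main statements

* `lieDeriv_add`, `lieDeriv_smul` (real), `isArchSmooth_lieDeriv` (sorried; BJ §1.5),
  `applyFree_congr` (sorried: the word action on smooth functions factors through `U(𝔤)`,
  i.e. `[X, Y] φ = X (Y φ) - Y (X φ)`; BJ §1.5), `IsZFinite.of_hasZCharacter` (real),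
  `isKFinite_translate` (real).

## Design notes

* (H1) `attribute [local instance 100] LieRing.ofAssociativeRing`, as in `RealMatrixGroups`.
* (H3/H4) The normed structure on `𝔤 ≤ Matrix N N A` is opened only with
  `open scoped Matrix.Norms.Operator in`; smoothness is `ContDiff ℝ ∞` (`open scoped ContDiff`).
* Mathlib has `FreeAlgebra`, `FreeAlgebra.basisFreeMonoid`, `FreeAlgebra.lift`,
  `UniversalEnvelopingAlgebra` (with `ι`, `lift`), `Subalgebra.center`, `deriv`, `ContDiff`,
  `Representation`; it has no Lie derivatives of functions on a group, no `Z(𝔤)`-finiteness and no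
  `K`-finiteness of functions. `centerU` is the accepted `Literature.NumberTheory.Automorphic.centerU` (GKModules).
* `isArchSmooth_lieDeriv` and `applyFree_congr` are stated for finite-dimensional `A`; they are
  the standard facts when `H.lie` is the Lie algebra of the closed subgroup `H.carrier`
  (BJ §1.5; Wallach, *Real Reductive Groups I*, §1.6).

## References

* A. Borel, H. Jacquet, *Automorphic forms and automorphic representations*, Proc. Sympos. Pure
  Math. 33 (Corvallis 1979), part 1, 189–202, §1.1–1.6 and §4.2.
* N. R. Wallach, *Real Reductive Groups I*, Academic Press 1988, §1.6.
-/

-- Mathlib idiom (Mathlib/Algebra/Lie/OfAssociative.lean); needed to mention Lie subalgebras of matrix algebras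
attribute [local instance 100] LieRing.ofAssociativeRing

open scoped MatrixGroups Matrix ContDiff

noncomputable section

namespace Literature.NumberTheory.Automorphic

variable {A : Type*} [NormedCommRing A] [NormedAlgebra ℝ A] [NormedAlgebra ℚ A] [CompleteSpace A]
  [StarRing A] {N : Type*} [Fintype N] [DecidableEq N] {H : RealMatrixGroup A N}
  {G : Type*} [Group G] (ι : H.carrier →* G)

/-! ## Smoothness in the archimedean variable -/

open scoped Matrix.Norms.Operator in
/-- `φ : G → ℂ` is *smooth in the archimedean variable* (with respect to `ι : H → G`) if for every
`g : G` the function `X ↦ φ (g · ι (exp X))` is `C^∞` on `𝔤 = H.lie`.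
Borel–Jacquet 1979, §1.1 and §4.1 (smoothness of `f (x_∞ · x_f)` in `x_∞`). [cite: BorelJacquet1979, §1.1 and §4.1 (smoothness of  f (x_∞ · x] -/
def IsArchSmooth (φ : G → ℂ) : Prop :=
  ∀ g : G, ContDiff ℝ ∞ fun X : H.lie.toSubmodule ↦ φ (g * ι (H.expMem ⟨X, X.2⟩))

open scoped Matrix.Norms.Operator in
/-- The complex subspace of functions `G → ℂ` that are smooth in the archimedean variable.
Borel–Jacquet 1979, §1.1. [cite: BorelJacquet1979, §1.1] -/
def archSmooth : Submodule ℂ (G → ℂ) where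
  carrier := {φ | IsArchSmooth ι φ}
  zero_mem' g := by simpa using contDiff_const
  add_mem' {φ ψ} hφ hψ g := by simpa using (hφ g).add (hψ g)
  smul_mem' c φ hφ g := by simpa using (hφ g).const_smul c

/-- Membership in `archSmooth ι` is `IsArchSmooth ι`. Borel–Jacquet 1979, §1.1. [cite: BorelJacquet1979, §1.1] -/
theorem mem_archSmooth_iff (φ : G → ℂ) : φ ∈ archSmooth ι ↔ IsArchSmooth ι φ :=
  Iff.rfl

/-! ## Lie derivatives and the word action of `U(𝔤)` -/

/-- The *Lie derivative* of `φ` along `X ∈ 𝔤` through right translation: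
`(X φ)(g) = d/dt φ (g · ι (exp tX)) |_{t=0}` (Mathlib's `deriv`, junk value `0` where the
derivative does not exist). Borel–Jacquet 1979, §1.5. [cite: BorelJacquet1979, §1.5] -/
def lieDeriv (X : H.lie) (φ : G → ℂ) (g : G) : ℂ :=
  deriv (fun t : ℝ ↦ φ (g * ι (H.expMem (t • X)))) 0

/-- Iterated Lie derivative along a word: `iterLieDeriv ι [X₁, …, Xₙ] φ = X₁ (X₂ (⋯ (Xₙ φ)))`,
`iterLieDeriv ι [] φ = φ`. Borel–Jacquet 1979, §1.5. [cite: BorelJacquet1979, §1.5] -/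
def iterLieDeriv : List H.lie → (G → ℂ) → (G → ℂ)
  | [], φ => φ
  | X :: w, φ => lieDeriv ι X (iterLieDeriv w φ)

/-- `iterLieDeriv ι [] φ = φ`. Borel–Jacquet 1979, §1.5. [cite: BorelJacquet1979, §1.5] -/
@[simp]
theorem iterLieDeriv_nil (φ : G → ℂ) : iterLieDeriv ι [] φ = φ := rfl

/-- `iterLieDeriv ι (X :: w) φ = X (iterLieDeriv ι w φ)`. Borel–Jacquet 1979, §1.5. [cite: BorelJacquet1979, §1.5] -/
@[simp]
theorem iterLieDeriv_cons (X : H.lie) (w : List H.lie) (φ : G → ℂ) :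
    iterLieDeriv ι (X :: w) φ = lieDeriv ι X (iterLieDeriv ι w φ) := rfl

/-- The action of a non-commutative real polynomial `p ∈ ℝ⟨𝔤⟩ = FreeAlgebra ℝ 𝔤` on functions:
write `p = ∑_w c_w · w` in the word basis `FreeAlgebra.basisFreeMonoid` and set
`p φ := ∑_w c_w · iterLieDeriv ι w φ`. This is total (no smoothness needed); on smooth `φ` it
factors through `U(𝔤)` (`applyFree_congr`). Borel–Jacquet 1979, §1.5–1.6. [cite: BorelJacquet1979, §1.5–1.6] -/
def applyFree (p : FreeAlgebra ℝ H.lie) (φ : G → ℂ) : G → ℂ :=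
  ((FreeAlgebra.basisFreeMonoid ℝ H.lie).repr p).sum
    fun w c ↦ (c : ℂ) • iterLieDeriv ι (FreeMonoid.toList w) φ

variable (H) in
/-- The canonical surjection `ℝ⟨𝔤⟩ = FreeAlgebra ℝ 𝔤 →ₐ[ℝ] U(𝔤)` sending a generator `X` to
`ι X` (`FreeAlgebra.lift` of `UniversalEnvelopingAlgebra.ι`). Borel–Jacquet 1979, §1.5;
Dixmier, *Enveloping Algebras*, 2.1.1. [cite: BorelJacquet1979, §1.5] -/
def freeToEnveloping : FreeAlgebra ℝ H.lie →ₐ[ℝ] UniversalEnvelopingAlgebra ℝ H.lie :=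
  FreeAlgebra.lift ℝ (UniversalEnvelopingAlgebra.ι ℝ)

/-- `freeToEnveloping` sends the generator `X` to `ι X ∈ U(𝔤)`. Dixmier, 2.1.1. [folklore] -/
@[simp]
theorem freeToEnveloping_ι (X : H.lie) :
    freeToEnveloping H (FreeAlgebra.ι ℝ X) = UniversalEnvelopingAlgebra.ι ℝ X :=
  FreeAlgebra.lift_ι_apply _ _

/-- A non-commutative polynomial `p ∈ ℝ⟨𝔤⟩` is a *central word* if its image in `U(𝔤)` lies in
the centre `Z(𝔤) = centerU H`. Borel–Jacquet 1979, §1.6. [cite: BorelJacquet1979, §1.6] -/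
def IsCentralWord (p : FreeAlgebra ℝ H.lie) : Prop :=
  freeToEnveloping H p ∈ centerU H

/-- The complex span of the functions `z φ` for `z` a central word: the `Z(𝔤)`-orbit span of `φ`.
Borel–Jacquet 1979, §1.6. [cite: BorelJacquet1979, §1.6] -/
def zOrbitSpan (φ : G → ℂ) : Submodule ℂ (G → ℂ) :=
  Submodule.span ℂ {ψ | ∃ p : FreeAlgebra ℝ H.lie, IsCentralWord p ∧ ψ = applyFree ι p φ}

/-- `φ` is *`Z(𝔤)`-finite*: the functions `z φ`, `z ∈ Z(𝔤)` (acting through central words),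
span a finite-dimensional complex vector space. Borel–Jacquet 1979, §1.6 and §4.2(c). [cite: BorelJacquet1979, §1.6 and §4.2(c] -/
def IsZFinite (φ : G → ℂ) : Prop :=
  FiniteDimensional ℂ (zOrbitSpan ι φ)

/-- `φ` has *`Z(𝔤)`-character* `θ : Z(𝔤) →ₐ[ℝ] ℂ`: every central word `z` acts on `φ` by the
scalar `θ z`, i.e. `z φ = θ(z) φ` (so `φ` is annihilated by the ideal `ker θ` of `Z(𝔤)`).
Borel–Jacquet 1979, §1.6 and §4.4. [cite: BorelJacquet1979, §1.6 and §4.4] -/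
def HasZCharacter (φ : G → ℂ) (θ : centerU H →ₐ[ℝ] ℂ) : Prop :=
  ∀ (p : FreeAlgebra ℝ H.lie) (hp : IsCentralWord p),
    applyFree ι p φ = θ ⟨freeToEnveloping H p, hp⟩ • φ

/-! ## Right translation and `K`-finiteness -/

/-- Right translation by the archimedean group: `(archTranslate ι h φ)(g) = φ (g · ι h)`, a
complex representation of `H` on `G → ℂ`. Borel–Jacquet 1979, §1.3 and §4.2. [cite: BorelJacquet1979, §1.3 and §4.2] -/
def archTranslate : Representation ℂ H.carrier (G → ℂ) where
  toFun h :=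
    { toFun := fun φ g ↦ φ (g * ι h)
      map_add' := fun _ _ ↦ rfl
      map_smul' := fun _ _ ↦ rfl }
  map_one' := by ext; simp
  map_mul' h h' := by ext; simp [mul_assoc]

/-- `archTranslate ι h φ g = φ (g * ι h)`. Borel–Jacquet 1979, §1.3. [cite: BorelJacquet1979, §1.3] -/
@[simp]
theorem archTranslate_apply (h : H.carrier) (φ : G → ℂ) (g : G) :
    archTranslate ι h φ g = φ (g * ι h) := rfl

/-- The complex span of the right `K`-translates `r(k) φ`, `k ∈ K = H.maximalCompact`.
Borel–Jacquet 1979, §1.3. [cite: BorelJacquet1979, §1.3] -/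
def kTranslateSpan (φ : G → ℂ) : Submodule ℂ (G → ℂ) :=
  Submodule.span ℂ (Set.range fun k : H.maximalCompact ↦
    archTranslate ι (Subgroup.inclusion H.maximalCompact_le_carrier k) φ)

/-- `r(k) φ` lies in the span of the `K`-translates of `φ`. Borel–Jacquet 1979, §1.3. [cite: BorelJacquet1979, §1.3] -/
theorem archTranslate_mem_kTranslateSpan (k : H.maximalCompact) (φ : G → ℂ) :
    archTranslate ι (Subgroup.inclusion H.maximalCompact_le_carrier k) φ ∈ kTranslateSpan ι φ :=
  Submodule.subset_span ⟨k, rfl⟩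

/-- `φ` is *`K`-finite* (on the right, `K = H.maximalCompact`): the right translates `r(k) φ`,
`k ∈ K`, span a finite-dimensional complex vector space. Borel–Jacquet 1979, §1.3 and §4.2(b). [cite: BorelJacquet1979, §1.3 and §4.2(b] -/
def IsKFinite (φ : G → ℂ) : Prop :=
  FiniteDimensional ℂ (kTranslateSpan ι φ)

/-! ## API -/

variable {ι}

/-- Additivity of the Lie derivative on archimedean-smooth functions. Borel–Jacquet 1979, §1.5. [cite: BorelJacquet1979, §1.5] -/
def lieDeriv_add : Prop :=
  ∀ (X : H.lie) {φ ψ : G → ℂ} (hφ : IsArchSmooth ι φ) (hψ : IsArchSmooth ι ψ),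
    lieDeriv ι X (φ + ψ) = lieDeriv ι X φ + lieDeriv ι X ψ

/-- Homogeneity of the Lie derivative (no smoothness needed: `deriv_const_smul_field`).
Borel–Jacquet 1979, §1.5. [cite: BorelJacquet1979, §1.5] -/
theorem lieDeriv_smul (X : H.lie) (c : ℂ) (φ : G → ℂ) :
    lieDeriv ι X (c • φ) = c • lieDeriv ι X φ := by
  funext g
  simp only [lieDeriv, Pi.smul_apply]
  exact deriv_fun_const_smul_field c _

/-- The Lie derivative of an archimedean-smooth function is archimedean-smooth (for `A`
finite-dimensional, `H.lie` the Lie algebra of the closed subgroup `H.carrier`).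
Borel–Jacquet 1979, §1.5; Wallach, *Real Reductive Groups I*, §1.6.2. [cite: BorelJacquet1979, §1.5] -/
def isArchSmooth_lieDeriv : Prop :=
  ∀ [FiniteDimensional ℝ A] (X : H.lie) {φ : G → ℂ} (hφ : IsArchSmooth ι φ),
    IsArchSmooth ι (lieDeriv ι X φ)

/-- On archimedean-smooth functions the word action factors through `U(𝔤)`: if `p` and `q` have
the same image in `U(𝔤)` then `p φ = q φ` (i.e. `X ↦ lieDeriv ι X` is a real Lie algebra action,
`[X, Y] φ = X (Y φ) - Y (X φ)`, and `U(𝔤) = ℝ⟨𝔤⟩ / (XY - YX - [X, Y])`).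
Borel–Jacquet 1979, §1.5; Dixmier, *Enveloping Algebras*, 2.1.1. [cite: BorelJacquet1979, §1.5] -/
def applyFree_congr : Prop :=
  ∀ [FiniteDimensional ℝ A] {p q : FreeAlgebra ℝ H.lie} (h : freeToEnveloping H p = freeToEnveloping H q) {φ : G → ℂ} (hφ : IsArchSmooth ι φ),
    applyFree ι p φ = applyFree ι q φ

/-- A function with a `Z(𝔤)`-character is `Z(𝔤)`-finite (its `Z(𝔤)`-orbit spans a line).
Borel–Jacquet 1979, §1.6 and §4.4. [cite: BorelJacquet1979, §1.6 and §4.4] -/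
theorem IsZFinite.of_hasZCharacter {φ : G → ℂ} {θ : centerU H →ₐ[ℝ] ℂ}
    (h : HasZCharacter ι φ θ) : IsZFinite ι φ := by
  refine Submodule.finiteDimensional_of_le (S₂ := Submodule.span ℂ {φ}) (Submodule.span_le.mpr ?_)
  rintro _ ⟨p, hp, rfl⟩
  rw [h p hp]
  exact Submodule.smul_mem _ _ (Submodule.subset_span rfl)

/-- Right `K`-translates of a `K`-finite function are `K`-finite (the `K`-orbit of `r(k) φ` is
that of `φ`). Borel–Jacquet 1979, §1.3. [cite: BorelJacquet1979, §1.3] -/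
theorem isKFinite_translate (k : H.maximalCompact) {φ : G → ℂ} (hφ : IsKFinite ι φ) :
    IsKFinite ι (archTranslate ι (Subgroup.inclusion H.maximalCompact_le_carrier k) φ) := by
  unfold IsKFinite at hφ ⊢
  refine Submodule.finiteDimensional_of_le (S₂ := kTranslateSpan ι φ) (Submodule.span_le.mpr ?_)
  rintro _ ⟨k', rfl⟩
  dsimp only
  rw [← Module.End.mul_apply, ← map_mul, ← map_mul]
  exact archTranslate_mem_kTranslateSpan ι _ φ

end Literature.NumberTheory.Automorphic
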